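import Mathlib
import HarnessLib

/-!
# LatticeQCDFlow / Scaling — the diagonal cumulant law for UNBOUNDED statistics with exponential
# moments: `0 ∈ interior(integrableExpSet)` ⇒ `n·cgf(c/√n) → c²σ²/2`, `M(c/√n)^n → e^{c²σ²/2}`,
# ESS fraction `→ e^{−c²σ²}`

HONEST FRAMING: exact (Metropolis-corrected) sampling algorithms for lattice gauge theory;
figures of merit are autocorrelation/cost numbers at stated couplings and volumes; no
continuum-physics claim.

Venture `LatticeQCDFlow` (cell pub-lqcd), topic `Scaling`; FANOUT row 3 (`s0-u1-a`, S0-B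
implementation A, GEN-20).  NEW WORK of the cell (elementary, Mathlib only: `analyticOnNhd_cgf`, the
Lagrange form `exists_cgf_eq_iteratedDeriv_two_cgf_mul`, `variance_tilted_mul`); NO definition is
introduced; nothing is cited.  Row 3's GEN-19 `Scaling/CumulantDiagonalLimit` proved the same three
limits for a BOUNDED statistic and listed "unbounded statistics (an open `integrableExpSet` around `0`
would suffice)" as NOT CLAIMED; this file proves exactly that: only finiteness of the exponential
moments `E e^{tX}` for `t` in a neighbourhood of `0` (sub-exponential tails — non-compact fields,
unbounded actions at an interior coupling) is used.

## Content (all `[ours]`), `μ` a probability measure, `X` centred with `0 ∈ interior(integrableExpSet X μ)`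

* `iteratedDeriv_two_cgf_zero_of_mem_interior` — `cgf″(0) = Var X`;
  `continuousAt_iteratedDeriv_two_cgf` — `cgf″` is continuous at `0`;
* **`tendsto_nat_mul_cgf_div_sqrt_of_mem_interior`** — `n·cgf(c/√n) → c²·Var X/2`;
* **`tendsto_mgf_div_sqrt_pow_of_mem_interior`** — `M(c/√n)^n → exp(c²·Var X/2)`;
* **`tendsto_essFrac_diag_of_mem_interior`** — `(M(β)²/M(2β))^n` at `β = c/√n` `→ e^{−c²σ²}`.

Reading (value-free): the loss side of the diagonal dictionary (`KL_n → s/2`, `ESS → e^{−s}`) does not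
need bounded blocks; exponential moments near the origin suffice.
NOT CLAIMED: the acceptance leg for unbounded statistics (needs the uniform second-moment bound of
`Scaling/IdentityFlowAcceptanceDiagonalLimit` along the sequence, not only at the limit); rates; any
value at the cell's `(β, L)`; nothing re-scored.
-/

noncomputable section

namespace Summit.Ventures.LatticeQCDFlow.Theory2

open MeasureTheory ProbabilityTheory Filter Finset Real Set
open scoped Topology NNReal

section Subexponential

variable {Ω : Type*} {mΩ : MeasurableSpace Ω} {μ : Measure Ω} [IsProbabilityMeasure μ] {X : Ω → ℝ}

/-- `cgf″(0) = Var X` as soon as `0` is interior to the domain of the moment generating function.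
[ours] -/
theorem iteratedDeriv_two_cgf_zero_of_mem_interior (h0 : (0 : ℝ) ∈ interior (integrableExpSet X μ)) :
    iteratedDeriv 2 (cgf X μ) 0 = Var[X; μ] := by
  rw [← variance_tilted_mul h0]
  simp only [zero_mul]
  rw [show (fun _ : Ω => (0 : ℝ)) = (0 : Ω → ℝ) from rfl, tilted_zero]

omit [IsProbabilityMeasure μ] in
/-- `cgf″` is continuous at `0` (indeed analytic on the open domain). [ours] -/
theorem continuousAt_iteratedDeriv_two_cgf (h0 : (0 : ℝ) ∈ interior (integrableExpSet X μ)) :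
    ContinuousAt (iteratedDeriv 2 (cgf X μ)) 0 := by
  have han : AnalyticOnNhd ℝ (cgf X μ) (interior (integrableExpSet X μ)) := analyticOnNhd_cgf
  have h2 := han.iterated_deriv 2
  rw [← iteratedDeriv_eq_iterate] at h2
  exact (h2 0 h0).continuousAt

/-- **`n·cgf(c/√n) → c²σ²/2`** for a centred statistic with exponential moments near `0`, `c ≥ 0`.
[ours] -/
theorem tendsto_nat_mul_cgf_div_sqrt_of_mem_interior_of_nonneg
    (h0 : (0 : ℝ) ∈ interior (integrableExpSet X μ)) (hc : μ[X] = 0) {c : ℝ} (hc0 : 0 ≤ c) :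
    Tendsto (fun n : ℕ => (n : ℝ) * cgf X μ (c / Real.sqrt n)) atTop
      (𝓝 (c ^ 2 * Var[X; μ] / 2)) := by
  rcases hc0.eq_or_lt with hz | hcpos
  · subst hz
    simp only [zero_div, cgf_zero, mul_zero, ne_eq, OfNat.ofNat_ne_zero, not_false_eq_true,
      zero_pow, zero_mul]
    exact tendsto_const_nhds
  -- a ball around `0` inside the (open) domain
  obtain ⟨δ, hδ, hball⟩ := Metric.isOpen_iff.1 isOpen_interior 0 h0
  -- the couplings are eventually inside the ball
  have hcn : Tendsto (fun n : ℕ => c / Real.sqrt n) atTop (𝓝 0) := by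
    have := (tendsto_inv_atTop_zero.comp
      (Real.tendsto_sqrt_atTop.comp tendsto_natCast_atTop_atTop)).const_mul c
    simpa [div_eq_mul_inv] using this
  have hsmall : ∀ᶠ n : ℕ in atTop, c / Real.sqrt n < δ := (tendsto_order.1 hcn).2 δ hδ
  -- Lagrange form for each `n ≥ 1` with `c/√n < δ`
  have hL : ∀ n : ℕ, 0 < n → c / Real.sqrt n < δ → ∃ u ∈ Set.Ioo 0 (c / Real.sqrt n),
      cgf X μ (c / Real.sqrt n) = iteratedDeriv 2 (cgf X μ) u * (c / Real.sqrt n) ^ 2 / 2 := by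
    intro n hn hlt
    have ht : 0 < c / Real.sqrt n := div_pos hcpos (Real.sqrt_pos.2 (Nat.cast_pos.2 hn))
    refine exists_cgf_eq_iteratedDeriv_two_cgf_mul ht hc fun s hs => hball ?_
    rw [Metric.mem_ball, Real.dist_eq, sub_zero, abs_of_nonneg hs.1]
    exact lt_of_le_of_lt hs.2 hlt
  classical
  let u : ℕ → ℝ := fun n =>
    if hn : 0 < n ∧ c / Real.sqrt n < δ then (hL n hn.1 hn.2).choose else 0
  have hu_mem : ∀ n : ℕ, 0 < n → c / Real.sqrt n < δ → u n ∈ Set.Ioo 0 (c / Real.sqrt n) :=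
    fun n hn hlt => by
      have h' : 0 < n ∧ c / Real.sqrt n < δ := ⟨hn, hlt⟩
      simp only [u, h', and_self, ↓reduceDIte]; exact (hL n hn hlt).choose_spec.1
  have hu_eq : ∀ n : ℕ, 0 < n → c / Real.sqrt n < δ →
      cgf X μ (c / Real.sqrt n) = iteratedDeriv 2 (cgf X μ) (u n) * (c / Real.sqrt n) ^ 2 / 2 :=
    fun n hn hlt => by
      have h' : 0 < n ∧ c / Real.sqrt n < δ := ⟨hn, hlt⟩
      simp only [u, h', and_self, ↓reduceDIte]; exact (hL n hn hlt).choose_spec.2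
  -- `u n → 0`
  have hu0 : Tendsto u atTop (𝓝 0) := by
    refine tendsto_of_tendsto_of_tendsto_of_le_of_le' tendsto_const_nhds hcn ?_ ?_
    · filter_upwards [eventually_gt_atTop 0, hsmall] with n hn hlt using (hu_mem n hn hlt).1.le
    · filter_upwards [eventually_gt_atTop 0, hsmall] with n hn hlt using (hu_mem n hn hlt).2.le
  have hlim : Tendsto (fun n => iteratedDeriv 2 (cgf X μ) (u n)) atTop (𝓝 (Var[X; μ])) := by
    rw [← iteratedDeriv_two_cgf_zero_of_mem_interior h0]
    exact (continuousAt_iteratedDeriv_two_cgf h0).tendsto.comp hu0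
  have hlim2 := hlim.mul_const (c ^ 2 / 2)
  rw [show Var[X; μ] * (c ^ 2 / 2) = c ^ 2 * Var[X; μ] / 2 by ring] at hlim2
  refine hlim2.congr' ?_
  filter_upwards [eventually_gt_atTop 0, hsmall] with n hn hlt
  rw [hu_eq n hn hlt]
  have hn' : (0 : ℝ) < n := Nat.cast_pos.2 hn
  rw [div_pow, Real.sq_sqrt hn'.le]
  field_simp

/-- **`n·cgf(c/√n) → c²σ²/2`** for a centred statistic with exponential moments near `0`, every
real `c` (reflection `X ↦ −X` for `c < 0`; the domain of `−X` is the mirror image). [ours] -/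
theorem tendsto_nat_mul_cgf_div_sqrt_of_mem_interior
    (h0 : (0 : ℝ) ∈ interior (integrableExpSet X μ)) (hc : μ[X] = 0) (c : ℝ) :
    Tendsto (fun n : ℕ => (n : ℝ) * cgf X μ (c / Real.sqrt n)) atTop
      (𝓝 (c ^ 2 * Var[X; μ] / 2)) := by
  rcases le_or_gt 0 c with hc0 | hc0
  · exact tendsto_nat_mul_cgf_div_sqrt_of_mem_interior_of_nonneg h0 hc hc0
  · -- pass to `−X`
    have hset : integrableExpSet (-X) μ = (Homeomorph.neg ℝ) ⁻¹' integrableExpSet X μ := by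
      ext t
      simp only [integrableExpSet, Set.mem_preimage, Set.mem_setOf_eq, Pi.neg_apply, mul_neg,
        Homeomorph.neg, Homeomorph.homeomorph_mk_coe, Equiv.neg_apply, neg_mul]
    have h0' : (0 : ℝ) ∈ interior (integrableExpSet (-X) μ) := by
      rw [hset, ← Homeomorph.preimage_interior, Set.mem_preimage]
      simpa using h0
    have hc' : μ[-X] = 0 := by simp only [Pi.neg_apply, integral_neg, hc, neg_zero]
    have h := tendsto_nat_mul_cgf_div_sqrt_of_mem_interior_of_nonneg h0' hc' (neg_nonneg.2 hc0.le)
    rw [variance_neg, neg_sq] at h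
    refine h.congr fun n => ?_
    rw [cgf_neg, neg_div, neg_neg]

/-- **`M(c/√n)^n → exp(c²σ²/2)`** under exponential moments near `0`. [ours] -/
theorem tendsto_mgf_div_sqrt_pow_of_mem_interior
    (h0 : (0 : ℝ) ∈ interior (integrableExpSet X μ)) (hc : μ[X] = 0) (c : ℝ) :
    Tendsto (fun n : ℕ => mgf X μ (c / Real.sqrt n) ^ n) atTop
      (𝓝 (Real.exp (c ^ 2 * Var[X; μ] / 2))) := by
  obtain ⟨δ, hδ, hball⟩ := Metric.isOpen_iff.1 isOpen_interior 0 h0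
  have hcn : Tendsto (fun n : ℕ => c / Real.sqrt n) atTop (𝓝 0) := by
    have := (tendsto_inv_atTop_zero.comp
      (Real.tendsto_sqrt_atTop.comp tendsto_natCast_atTop_atTop)).const_mul c
    simpa [div_eq_mul_inv] using this
  have hsmall : ∀ᶠ n : ℕ in atTop, |c / Real.sqrt n| < δ := by
    have := (continuous_abs.tendsto 0).comp hcn
    rw [abs_zero] at this
    exact (tendsto_order.1 this).2 δ hδ
  have h := (Real.continuous_exp.tendsto _).comp (tendsto_nat_mul_cgf_div_sqrt_of_mem_interior h0 hc c)
  refine h.congr' ?_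
  filter_upwards [hsmall] with n hn
  have hi : Integrable (fun ω => Real.exp (c / Real.sqrt n * X ω)) μ := by
    have hmem : c / Real.sqrt n ∈ interior (integrableExpSet X μ) :=
      hball (by rw [Metric.mem_ball, Real.dist_eq, sub_zero]; exact hn)
    exact interior_subset (s := integrableExpSet X μ) hmem
  simp only [Function.comp_apply]
  rw [← exp_cgf hi, ← Real.exp_nat_mul]

/-- **THE ESS FRACTION ON THE DIAGONAL under exponential moments**: `(M(β)²/M(2β))^n` at
`β = c/√n` `→ e^{−c²σ²}`. [ours] -/
theorem tendsto_essFrac_diag_of_mem_interior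
    (h0 : (0 : ℝ) ∈ interior (integrableExpSet X μ)) (hc : μ[X] = 0) (c : ℝ) :
    Tendsto (fun n : ℕ => (mgf X μ (c / Real.sqrt n) ^ 2 / mgf X μ (2 * c / Real.sqrt n)) ^ n) atTop
      (𝓝 (Real.exp (-(c ^ 2 * Var[X; μ])))) := by
  have h1 := tendsto_mgf_div_sqrt_pow_of_mem_interior h0 hc c
  have h2 := tendsto_mgf_div_sqrt_pow_of_mem_interior h0 hc (2 * c)
  have h := (h1.pow 2).div h2 (Real.exp_pos _).ne'
  have e : Real.exp (c ^ 2 * Var[X; μ] / 2) ^ 2 / Real.exp ((2 * c) ^ 2 * Var[X; μ] / 2)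
      = Real.exp (-(c ^ 2 * Var[X; μ])) := by
    rw [← Real.exp_nat_mul, ← Real.exp_sub]
    congr 1
    ring
  rw [e] at h
  refine h.congr fun n => ?_
  simp only [Pi.div_apply]
  rw [div_pow, ← pow_mul, ← pow_mul, mul_comm n 2]

end Subexponential

end Summit.Ventures.LatticeQCDFlow.Theory2

end
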